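import Literature.Analysis.FluidPDE.TorusEnstrophyStrainIdentity
import Literature.Analysis.FluidPDE.TorusClassicalNSGalileanBoost
import HarnessLib

/-!
# Continuation of classical Navier–Stokes solutions on `T³` under a time-integrable sup bound on the
# strain-rate tensor (the Beale–Kato–Majda mechanism in strain form)

Analysis/FluidPDE proof file (theorems only; no definitions, no named facts, no `sorry`).
The deformation-tensor form of the Beale–Kato–Majda continuation principle (BKM 1984 for the
vorticity; the strain / deformation-tensor version goes back to Ponce 1985 and Kozono–Taniuchi 2000),
here for CLASSICAL solutions of the unforced equations on the flat torus `T^d`, `card d = 3`, any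
mean: if the entries of the strain-rate tensor `S = ½(∇u + ∇uᵀ)` are bounded by `M(t)` with
`∫₀ᵗ M ≤ I` on `[0, T)`, the solution continues to a classical solution past `T`.

* `abs_sum_strain_cube_le` — pointwise algebra: for a real `d × d` array `R` (here `Rⱼᵢ = ∂ⱼuᵢ`) with
  symmetrised entries `Sᵢⱼ = ½(Rⱼᵢ + Rᵢⱼ)` bounded by `M ≥ 0`,
  `|Σᵢⱼₖ Sᵢⱼ Sⱼₖ Sₖᵢ| ≤ card d · M · Σᵢⱼ Rᵢⱼ²`;
* `Torus.torusEnstrophy_le_mul_exp_integral_strainBound` — Grönwall: along a classical solution on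
  `[a, b] × T^d` with `|Sᵢⱼ(t, x)| ≤ M(t)` (`M` continuous, `≥ 0`),
  `ℰ(u t) ≤ ℰ(u a) · exp(8 ∫ₐᵗ M)` (`ℰ = ½‖∇u‖₂²`), from the strain form of the enstrophy balance
  `dℰ/dt = −ν‖Δu‖₂² − (4/3)∫ tr S³` (tree
  `Torus.IsClassicalNSSolutionOn.hasDerivWithinAt_torusEnstrophy_strain`, Miller 2023 Prop. 1.9) and
  the tree's Grönwall lemma `le_mul_exp_integral_of_hasDerivWithinAt_le_mul`;
* `Torus.classicalNS_continuation_of_strainBound` — **continuation**: on `[0, T) × T^d`, `ν > 0`, a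
  continuous nonnegative entrywise strain majorant `M` with bounded primitive `∫₀ᵗ M ≤ I` gives a
  classical solution on some `[0, T']`, `T' > T`, equal to `u` on `[0, T)` (enstrophy door
  `Torus.classicalNS_continuation_of_gradNormSq_le_anyMean`, RRS 2016 Lemma 6.11 / Thm 12.3).

Consumer: cell `ns-claims`, row C144 `Passolungo2025` (§2 p.1: «∫₀ᵀ‖S‖_∞ dt < ∞ … precludes finite-time
blow-up … via Beale–Kato–Majda» — the one classical mechanism of that text).

## References

* J. T. Beale, T. Kato, A. Majda, Comm. Math. Phys. 94 (1984) 61–66, Thm 1. [`BealeKatoMajda1984`]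
* J. C. Robinson, J. L. Rodrigo, W. Sadowski, CUP 2016, Thm 12.3 (BKM on `T³` via the `H¹` theory),
  Lemma 6.11. [`RobinsonRodrigoSadowskiCUP2016`]
* E. Miller, strain formulation of the enstrophy balance, Prop. 1.9. [`Miller2023StrainModel`]
* (for the record, not cited by tag) G. Ponce, Comm. Math. Phys. 98 (1985) 349–353; H. Kozono,
  Y. Taniuchi, Math. Z. 235 (2000) 173–194 — deformation-tensor / BMO forms of the criterion.

WHAT THIS IS NOT: not a claim about NS regularity or blow-up; not a claim about any author beyond the
typed locator.
-/

open Set MeasureTheory Finset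
open scoped InnerProductSpace RealInnerProductSpace

noncomputable section

namespace Literature.Analysis.FluidPDE

open Literature.Analysis.FunctionSpaces

variable {d : Type*} [Fintype d] [DecidableEq d]

/-! ## §1 Pointwise algebra: the strain cube against an entrywise bound -/

omit [DecidableEq d] in
/-- `|Σᵢⱼₖ Sᵢⱼ Sⱼₖ Sₖᵢ| ≤ card d · M · Σᵢⱼ Sᵢⱼ²` for an array with `|Sᵢⱼ| ≤ M` (`2|ab| ≤ a² + b²` and
counting). [cite: RobinsonRodrigoSadowskiCUP2016, Thm 12.3 (pointwise step)] -/
theorem abs_sum_cube_le_of_abs_le (S : d → d → ℝ) {M : ℝ} (hM0 : 0 ≤ M) (hM : ∀ i j, |S i j| ≤ M) :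
    |∑ i, ∑ j, ∑ k, S i j * S j k * S k i| ≤ Fintype.card d * M * ∑ i, ∑ j, S i j ^ 2 := by
  -- `|Σ| ≤ Σ |Sᵢⱼ||Sⱼₖ| M ≤ Σ (Sᵢⱼ² + Sⱼₖ²)/2 · M`
  have h1 : |∑ i, ∑ j, ∑ k, S i j * S j k * S k i| ≤
      ∑ i, ∑ j, ∑ k, (S i j ^ 2 + S j k ^ 2) / 2 * M := by
    refine (abs_sum_le_sum_abs _ _).trans (sum_le_sum fun i _ => ?_)
    refine (abs_sum_le_sum_abs _ _).trans (sum_le_sum fun j _ => ?_)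
    refine (abs_sum_le_sum_abs _ _).trans (sum_le_sum fun k _ => ?_)
    rw [abs_mul, abs_mul]
    have hab : |S i j| * |S j k| ≤ (S i j ^ 2 + S j k ^ 2) / 2 := by
      nlinarith [sq_nonneg (|S i j| - |S j k|), sq_abs (S i j), sq_abs (S j k),
        abs_nonneg (S i j), abs_nonneg (S j k)]
    calc |S i j| * |S j k| * |S k i| ≤ |S i j| * |S j k| * M :=
          mul_le_mul_of_nonneg_left (hM k i) (mul_nonneg (abs_nonneg _) (abs_nonneg _))
      _ ≤ (S i j ^ 2 + S j k ^ 2) / 2 * M := mul_le_mul_of_nonneg_right hab hM0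
  -- counting: `Σᵢⱼₖ Sᵢⱼ² = card d · Σᵢⱼ Sᵢⱼ²` and `Σᵢⱼₖ Sⱼₖ² = card d · Σⱼₖ Sⱼₖ²`
  have h2 : ∑ i, ∑ j, ∑ k, (S i j ^ 2 + S j k ^ 2) / 2 * M =
      Fintype.card d * M * ∑ i, ∑ j, S i j ^ 2 := by
    have hA : ∑ i, ∑ j, ∑ _k : d, S i j ^ 2 = Fintype.card d * ∑ i, ∑ j, S i j ^ 2 := by
      simp only [sum_const, card_univ, nsmul_eq_mul]
      rw [mul_sum]
      refine sum_congr rfl fun i _ => ?_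
      rw [mul_sum]
    have hB : ∑ _i : d, ∑ j, ∑ k, S j k ^ 2 = Fintype.card d * ∑ j, ∑ k, S j k ^ 2 := by
      simp only [sum_const, card_univ, nsmul_eq_mul]
    have hsplit : ∑ i, ∑ j, ∑ k, (S i j ^ 2 + S j k ^ 2) / 2 * M =
        M / 2 * (∑ i, ∑ j, ∑ _k : d, S i j ^ 2) + M / 2 * (∑ _i : d, ∑ j, ∑ k, S j k ^ 2) := by
      rw [mul_sum, mul_sum, ← sum_add_distrib]
      refine sum_congr rfl fun i _ => ?_
      rw [mul_sum, mul_sum, ← sum_add_distrib]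
      refine sum_congr rfl fun j _ => ?_
      rw [mul_sum, mul_sum, ← sum_add_distrib]
      refine sum_congr rfl fun k _ => ?_
      ring
    rw [hsplit, hA, hB]
    ring
  exact h1.trans (le_of_eq h2)

omit [DecidableEq d] in
/-- The symmetrised square is at most the mean of the squares: `Σᵢⱼ ((Rⱼᵢ + Rᵢⱼ)/2)² ≤ Σᵢⱼ Rᵢⱼ²`.
[cite: RobinsonRodrigoSadowskiCUP2016, Thm 12.3 (pointwise step)] -/
theorem sum_symm_sq_le (R : d → d → ℝ) :
    ∑ i, ∑ j, ((R j i + R i j) / 2) ^ 2 ≤ ∑ i, ∑ j, R i j ^ 2 := by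
  have h1 : ∑ i, ∑ j, ((R j i + R i j) / 2) ^ 2 ≤ ∑ i, ∑ j, (R j i ^ 2 + R i j ^ 2) / 2 :=
    sum_le_sum fun i _ => sum_le_sum fun j _ => by nlinarith [sq_nonneg (R j i - R i j)]
  have h2 : ∑ i, ∑ j, (R j i ^ 2 + R i j ^ 2) / 2 = ∑ i, ∑ j, R i j ^ 2 := by
    have hcomm : ∑ i, ∑ j, R j i ^ 2 = ∑ i, ∑ j, R i j ^ 2 := sum_comm
    have : ∑ i, ∑ j, (R j i ^ 2 + R i j ^ 2) / 2 =
        (∑ i, ∑ j, R j i ^ 2) / 2 + (∑ i, ∑ j, R i j ^ 2) / 2 := by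
      rw [← add_div, ← sum_add_distrib, Finset.sum_div]
      refine sum_congr rfl fun i _ => ?_
      rw [← sum_add_distrib, Finset.sum_div]
    rw [this, hcomm]
    ring
  exact h1.trans (le_of_eq h2)

omit [DecidableEq d] in
/-- **The strain cube against an entrywise strain bound**: with `Sᵢⱼ = ½(Rⱼᵢ + Rᵢⱼ)`, `|Sᵢⱼ| ≤ M`,
`|Σᵢⱼₖ Sᵢⱼ Sⱼₖ Sₖᵢ| ≤ card d · M · Σᵢⱼ Rᵢⱼ²`. [cite: RobinsonRodrigoSadowskiCUP2016, Thm 12.3 (pointwise step)] -/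
theorem abs_sum_strain_cube_le (R : d → d → ℝ) {M : ℝ} (hM0 : 0 ≤ M)
    (hM : ∀ i j, |(R j i + R i j) / 2| ≤ M) :
    |∑ i, ∑ j, ∑ k, ((R j i + R i j) / 2) * ((R k j + R j k) / 2) * ((R i k + R k i) / 2)| ≤
      Fintype.card d * M * ∑ i, ∑ j, R i j ^ 2 := by
  have h := abs_sum_cube_le_of_abs_le (fun i j => (R j i + R i j) / 2) hM0 hM
  refine h.trans ?_
  exact mul_le_mul_of_nonneg_left (sum_symm_sq_le R) (by positivity)

/-! ## §2 Enstrophy Grönwall under a strain bound -/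

/-- The integrand of `‖∇v‖₂²` as a double sum of squared entries: `Σᵢ ‖∂ᵢv(x)‖² = Σᵢⱼ (∂ᵢv(x))ⱼ²`.
[cite: RobinsonRodrigoSadowskiCUP2016, Thm 12.3 (pointwise step)] -/
theorem sum_norm_partialDeriv_sq_eq (v : UnitAddTorus d → EuclideanSpace ℝ d) (x : UnitAddTorus d) :
    ∑ i, ‖Torus.partialDeriv i v x‖ ^ 2 = ∑ i, ∑ j, Torus.partialDeriv i v x j ^ 2 := by
  refine sum_congr rfl fun i _ => ?_
  rw [EuclideanSpace.norm_sq_eq]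
  refine sum_congr rfl fun j _ => ?_
  rw [Real.norm_eq_abs, sq_abs]

/-- **Enstrophy under an entrywise strain majorant** (the strain form of RRS (12.11)–(12.12)): along a
classical solution of the unforced Navier–Stokes equations (`ν ≥ 0`) on `[a, b] × T^d`, `card d = 3`,
if `M` is continuous and nonnegative on `[a, b]` with `|½(∂ⱼuᵢ + ∂ᵢuⱼ)(s, x)| ≤ M(s)` for all `s, x, i, j`,
then `ℰ(u t) ≤ ℰ(u a) · exp(8 ∫ₐᵗ M)` for `t ∈ [a, b]` (`dℰ/dt = −ν‖Δu‖₂² − (4/3)∫tr S³ ≤ (4/3)·3M·‖∇u‖₂²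
= 8Mℰ`). [cite: Miller2023StrainModel, Prop. 1.9] [cite: RobinsonRodrigoSadowskiCUP2016, Thm 12.3 proof, (12.11)–(12.12)] -/
theorem Torus.torusEnstrophy_le_mul_exp_integral_strainBound (hd : Fintype.card d = 3)
    {ν a b : ℝ} (hν : 0 ≤ ν) (hab : a < b)
    {u : ℝ → UnitAddTorus d → EuclideanSpace ℝ d} {p : ℝ → UnitAddTorus d → ℝ}
    (h : Torus.IsClassicalNSSolutionOn (Icc a b) ν 0 u p)
    {M : ℝ → ℝ} (hMc : ContinuousOn M (Icc a b)) (hM0 : ∀ s ∈ Icc a b, 0 ≤ M s)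
    (hS : ∀ s ∈ Icc a b, ∀ x, ∀ i j,
      |(Torus.partialDeriv j (u s) x i + Torus.partialDeriv i (u s) x j) / 2| ≤ M s)
    {t : ℝ} (ht : t ∈ Icc a b) :
    torusEnstrophy (u t) ≤ torusEnstrophy (u a) * Real.exp (8 * ∫ s in a..t, M s) := by
  set F : ℝ → ℝ := fun s => -ν * (∫ x, ‖Torus.laplacian (u s) x‖ ^ 2) -
    (4 / 3) * ∫ x, ∑ i, ∑ j, ∑ k,
      ((Torus.partialDeriv j (u s) x i + Torus.partialDeriv i (u s) x j) / 2) *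
      ((Torus.partialDeriv k (u s) x j + Torus.partialDeriv j (u s) x k) / 2) *
      ((Torus.partialDeriv i (u s) x k + Torus.partialDeriv k (u s) x i) / 2) with hF
  have hder : ∀ s ∈ Icc a b, HasDerivWithinAt (fun r => torusEnstrophy (u r)) (F s) (Icc a b) s :=
    fun s hs => h.hasDerivWithinAt_torusEnstrophy_strain hd hab hs
  have hle : ∀ s ∈ Icc a b, F s ≤ (8 * M s) * torusEnstrophy (u s) := by
    intro s hs
    have hus : Torus.IsSmooth (u s) := h.smooth_velocity.isSmooth_slice hs
    -- the cube integrand is dominated pointwise by `3 M Σᵢⱼ (∂ᵢu)ⱼ² = 3M Σᵢ ‖∂ᵢu‖²`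
    have hpt : ∀ x, |∑ i, ∑ j, ∑ k,
        ((Torus.partialDeriv j (u s) x i + Torus.partialDeriv i (u s) x j) / 2) *
        ((Torus.partialDeriv k (u s) x j + Torus.partialDeriv j (u s) x k) / 2) *
        ((Torus.partialDeriv i (u s) x k + Torus.partialDeriv k (u s) x i) / 2)| ≤
        3 * M s * ∑ i, ‖Torus.partialDeriv i (u s) x‖ ^ 2 := by
      intro x
      have h0 := abs_sum_strain_cube_le (fun i j => Torus.partialDeriv i (u s) x j) (hM0 s hs)
        (fun i j => hS s hs x i j)
      rw [hd] at h0
      rw [sum_norm_partialDeriv_sq_eq]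
      exact_mod_cast h0
    have hgi : Integrable (fun x => ∑ i, ‖Torus.partialDeriv i (u s) x‖ ^ 2) volume :=
      (continuous_finsetSum _ fun i _ =>
        ((hus.partialDeriv i).continuous.norm.pow 2)).integrable_unitAddTorus
    have hbound : |∫ x, ∑ i, ∑ j, ∑ k,
        ((Torus.partialDeriv j (u s) x i + Torus.partialDeriv i (u s) x j) / 2) *
        ((Torus.partialDeriv k (u s) x j + Torus.partialDeriv j (u s) x k) / 2) *
        ((Torus.partialDeriv i (u s) x k + Torus.partialDeriv k (u s) x i) / 2)| ≤
        3 * M s * Torus.gradNormSq (u s) := by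
      refine (abs_integral_le_integral_abs).trans ?_
      rw [Torus.gradNormSq, ← integral_const_mul]
      refine integral_mono_of_nonneg (Filter.Eventually.of_forall fun x => abs_nonneg _)
        (hgi.const_mul _) (Filter.Eventually.of_forall fun x => hpt x)
    have hlap : 0 ≤ ∫ x, ‖Torus.laplacian (u s) x‖ ^ 2 := integral_nonneg fun x => sq_nonneg _
    have hE : Torus.gradNormSq (u s) = 2 * torusEnstrophy (u s) := gradNormSq_eq_two_mul_torusEnstrophy _
    have habs := (neg_le_abs _).trans hbound
    simp only [hF]
    nlinarith [habs, hlap, hν, hE, torusEnstrophy_nonneg (u s), hM0 s hs]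
  have hk : ContinuousOn (fun s => 8 * M s) (Icc a b) := continuousOn_const.mul hMc
  have hmain := le_mul_exp_integral_of_hasDerivWithinAt_le_mul hab hder hk hle ht
  rwa [intervalIntegral.integral_const_mul] at hmain

/-! ## §3 Continuation -/

/-- **Continuation past `T` under an integrable entrywise strain bound** (the deformation-tensor form of
the Beale–Kato–Majda mechanism on `T³`): let `(u, p)` be a classical solution of the unforced
Navier–Stokes equations with `ν > 0` on `[0, T) × T^d`, `card d = 3`, `T > 0` (any mean), and let `M` be
continuous and nonnegative on `[0, T)` with `|½(∂ⱼuᵢ + ∂ᵢuⱼ)(t, x)| ≤ M(t)` and `∫₀ᵗ M ≤ I` for all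
`t ∈ [0, T)`. Then there are `T' > T` and a classical solution `(u', p')` on the CLOSED window
`[0, T'] × T^d` with `u' = u` on `[0, T)`. (Enstrophy bound `‖∇u(t)‖₂² ≤ ‖∇u(0)‖₂² e^{8I}` by the previous
theorem on each `[0, t]`; enstrophy door `Torus.classicalNS_continuation_of_gradNormSq_le_anyMean`.)
[cite: RobinsonRodrigoSadowskiCUP2016, Thm 12.3 (with Lemma 6.11)] [cite: BealeKatoMajda1984, Theorem 1 and Corollary] -/
theorem Torus.classicalNS_continuation_of_strainBound (hd : Fintype.card d = 3) {ν T : ℝ}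
    (hν : 0 < ν) (hT : 0 < T) {u : ℝ → UnitAddTorus d → EuclideanSpace ℝ d}
    {p : ℝ → UnitAddTorus d → ℝ} (h : Torus.IsClassicalNSSolutionOn (Ico 0 T) ν 0 u p)
    {M : ℝ → ℝ} (hMc : ContinuousOn M (Ico 0 T)) (hM0 : ∀ t ∈ Ico 0 T, 0 ≤ M t)
    (hS : ∀ t ∈ Ico 0 T, ∀ x, ∀ i j,
      |(Torus.partialDeriv j (u t) x i + Torus.partialDeriv i (u t) x j) / 2| ≤ M t)
    {I : ℝ} (hI : ∀ t ∈ Ico 0 T, ∫ s in (0 : ℝ)..t, M s ≤ I) :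
    ∃ T' : ℝ, T < T' ∧ ∃ (u' : ℝ → UnitAddTorus d → EuclideanSpace ℝ d)
      (p' : ℝ → UnitAddTorus d → ℝ), Torus.IsClassicalNSSolutionOn (Icc 0 T') ν 0 u' p' ∧
        ∀ t ∈ Ico 0 T, u' t = u t := by
  have hbound : ∀ t ∈ Ico 0 T,
      Torus.gradNormSq (u t) ≤ Torus.gradNormSq (u 0) * Real.exp (8 * I) := by
    intro t ht
    rcases ht.1.eq_or_lt with h0 | h0t
    · rw [← h0]
      have : (1 : ℝ) ≤ Real.exp (8 * I) := by
        have hI0 : 0 ≤ I := le_trans (by simp) (hI 0 ⟨le_rfl, hT⟩)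
        exact Real.one_le_exp (by positivity)
      have hg : 0 ≤ Torus.gradNormSq (u 0) :=
        integral_nonneg fun x => Finset.sum_nonneg fun i _ => sq_nonneg _
      nlinarith
    · have hsub : Icc 0 t ⊆ Ico 0 T := fun s hs => ⟨hs.1, hs.2.trans_lt ht.2⟩
      have hmain := Torus.torusEnstrophy_le_mul_exp_integral_strainBound hd hν.le h0t
        (h.mono hsub (uniqueDiffOn_Icc h0t)) (hMc.mono hsub) (fun s hs => hM0 s (hsub hs))
        (fun s hs => hS s (hsub hs)) ⟨h0t.le, le_rfl⟩
      rw [gradNormSq_eq_two_mul_torusEnstrophy, gradNormSq_eq_two_mul_torusEnstrophy]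
      have hexp : Real.exp (8 * ∫ s in (0 : ℝ)..t, M s) ≤ Real.exp (8 * I) :=
        Real.exp_le_exp.2 (by linarith [hI t ht])
      have hE0 : 0 ≤ torusEnstrophy (u 0) := torusEnstrophy_nonneg _
      nlinarith [mul_le_mul_of_nonneg_left hexp hE0]
  exact Torus.classicalNS_continuation_of_gradNormSq_le_anyMean hd hν hT h hbound

end Literature.Analysis.FluidPDE

end
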